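import Summits.Ventures.LatticeQCDFlow.Scaling.UrnCompositionChainKernel

/-!
HONEST FRAMING: exact (Metropolis-corrected) sampling algorithms for lattice gauge theory; figures
of merit are autocorrelation/cost numbers at stated couplings and volumes; no continuum-physics
claim.

# UrnCompositionChainLaw — THE URN COMPOSITION CHAIN MIXES IN `O((K/p)·log(K/ε))` FOR EVERY CONTENT TYPE AND EVERY PAIR OF LAWS:
# `d(n) ≤ (K+1)(2K+4)·(1 − p/(2K+4))ⁿ`, `t_mix(ε) ≤ ⌈((2K+4)/p)·log((K+1)(2K+4)/ε)⌉₊` (lean-2 GEN-35, ours)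

Venture-side (OURS).  Cell `lqcd-flow` (pub-lqcd), unit `pub-lqcd-lean-2-g35`, 2026-08-29.  Chapter V (composition variables), file 7b: the Markov-chain statement behind
file 6 (`UrnProductCertificate`), on the kernel ∕ coupling plumbing of file 7a (`UrnCompositionChainKernel`).  THE CHAIN (the `τ = ∞` caricature of the refresh cycle of the homogeneous `q`-content star, `lean-2/MEMO-gen34` §7, `MEMO-gen35` §2): a
finite state space `X` in bijection (`comp`, hypotheses `hinj`, `hsurj`) with the compositions `N : S → ℕ` of `K + 1` particles; one step deletes a particle of content `a` with
probability `u_x(a) = (N(a)/W(a))/Z_x` and inserts a fresh `μ_0`-particle: `P(x,x') = Σ_{a,z} u_x(a)μ_0(z)·𝟙{comp x' + δ_a = comp x + δ_z}`.  THE COUPLING: the two deletions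
coupled optimally (LPW Prop. 4.7, tree), the insertion shared: `Q((x,y),(x',y')) = Σ_{a,b,z} q_{xy}(a,b)μ_0(z)𝟙{…x…}𝟙{…y…}` — a Markovian coupling of `P` (hypothesis-equations
`hP`, `hQ`; no definitions).  THE POTENTIAL `Ψ(x,y) = Δ(comp x, comp y)·(2 + Σ_v θ_v(comp x + comp y)(v))`, `θ = 1/(1+pW)`, satisfies `Q·Ψ ≤ (1 − p/(2K+4))·Ψ` (file 6),
`Ψ ≥ 𝟙{x ≠ y}`, `Ψ ≤ (K+1)(2K+4)`; hence by LPW Cor. 5.5 (tree) the law of this file.  Requires `0 < p`, `p·W ≤ 1`, `μ_0` a probability vector with `Σ μ_0 W = 1`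
(i.e. `μ_1 = μ_0 W` normalised), `π` any stationary law of `P`.

## What is proved

* (files 7a: kernel, coupling, bookkeeping.)
* §3 `urnChain_mass_add_single`, **`urnChain_mulVec_potential`** (`(Q·Ψ)(x,y)` is the left side of file 6), **`urnChain_contract`** (`Q·Ψ ≤ (1 − p/(2K+4))Ψ`),
  `urnChain_potential_bounds` (`𝟙{x≠y} ≤ Ψ ≤ (K+1)(2K+4)`, `Ψ ≥ 0`).
* §4 **`urnChain_worstTvDist_le`** — `d(n) ≤ (K+1)(2K+4)·(1 − p/(2K+4))ⁿ`; **`urnChain_mixingTime_le`** — `t_mix(ε) ≤ ⌈((2K+4)/p)·log((K+1)(2K+4)/ε)⌉₊`.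

Reading (no numerics implied): the conjectured law-free order `(K/p)·log(K/ε)` of OPEN-MATH item 1 (i), every `q`, every pair of laws, for the `τ = ∞` composition chain —
the first fast-swap law of the programme that is uniform in the content type.  NOT CLAIMED: anything for the star at finite swap odds (there the end-hub law needs the hub term,
MEMO-gen35 §5).  Literature grade (cell rule): OWN, elementary on the tree's LPW files; nothing cited as a fact; no new bib keys.
-/

open Finset Matrix
open Literature.Probability.MarkovChains

namespace Summit.Ventures.LatticeQCDFlow.Scaling

section UrnChainLaw
variable {X : Type*} [Fintype X] [DecidableEq X] {S : Type*} [Fintype S] [DecidableEq S]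
variable {comp : X → S → ℕ} {K : ℕ} {W θ μ0 : S → ℝ} {p : ℝ} {Zc : X → ℝ} {u : X → S → ℝ}
variable {P : X → X → ℝ} {Q : Matrix (X × X) (X × X) ℝ} {Δ : (S → ℕ) → (S → ℕ) → ℕ} {Ψ : X × X → ℝ}

/-! ## §3 The potential: `(Q·Ψ)(x,y)` is the left side of file 6 -/

omit [DecidableEq X] [Fintype X] in
/-- Masses: `Σ_v θ_v (M + δ_c)(v) = Σ_v θ_v M(v) + θ_c`. [ours] -/
theorem urnChain_mass_add_single (M : S → ℕ) (c : S) :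
    ∑ v, θ v * ((M + Pi.single c 1 : S → ℕ) v : ℝ) = ∑ v, θ v * (M v : ℝ) + θ c := by
  simp only [Pi.add_apply, Nat.cast_add, mul_add, sum_add_distrib]
  congr 1
  rw [Finset.sum_eq_single c]
  · simp
  · intro v _ hv; simp [hv]
  · intro h; exact absurd (mem_univ c) h

omit [DecidableEq X] in
/-- **`(Q·Ψ)(x,y) = Σ_{a,b} q(a,b)·Δ(M^a_x, M^b_y)·(Φ + 2E_{μ_0}θ − θ_a − θ_b)`** with `Φ = 2 + Σθ(comp x + comp y)`, `M^a_x = comp x − δ_a`. [ours] -/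
theorem urnChain_mulVec_potential (hinj : Function.Injective comp) (hsum : ∀ x, ∑ v, comp x v = K + 1)
    (hsurj : ∀ N : S → ℕ, ∑ v, N v = K + 1 → ∃ x, comp x = N) (hW : ∀ v, 0 < W v) (hμ1 : ∑ v, μ0 v = 1)
    (hZ : ∀ x, Zc x = ∑ v, (comp x v : ℝ) / W v) (hu : ∀ x v, u x v = (comp x v : ℝ) / W v / Zc x)
    (hΔ : ∀ N N', Δ N N' = ∑ v, (N v - N' v))
    (hQ : ∀ x y x' y', Q (x, y) (x', y') = ∑ a, ∑ b, ∑ z, optimalCoupling (u x) (u y) a b * μ0 z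
      * (if comp x' + Pi.single a 1 = comp x + Pi.single z 1 then (1 : ℝ) else 0) * (if comp y' + Pi.single b 1 = comp y + Pi.single z 1 then (1 : ℝ) else 0))
    (hΨ : ∀ x y, Ψ (x, y) = (Δ (comp x) (comp y) : ℝ) * (2 + ∑ v, θ v * ((comp x v : ℝ)) + ∑ v, θ v * (comp y v : ℝ))) (x y : X) :
    (Q *ᵥ Ψ) (x, y)
      = ∑ a, ∑ b, optimalCoupling (u x) (u y) a b * ((Δ (comp x - Pi.single a 1) (comp y - Pi.single b 1) : ℝ)
          * ((2 + ∑ v, θ v * (comp x v : ℝ) + ∑ v, θ v * (comp y v : ℝ)) + 2 * ∑ v, μ0 v * θ v - θ a - θ b)) := by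
  have hZ0 := urnChain_Z_pos hsum hW hZ
  have hq := optimalCoupling_isCoupling (urn_law_nonneg hW (hZ0 x) (hu x)) (urn_law_nonneg hW (hZ0 y) (hu y)) (urn_law_sum_eq_one (hZ x) (hZ0 x) (hu x))
    (urn_law_sum_eq_one (hZ y) (hZ0 y) (hu y))
  -- Step 1: `(Q·Ψ)(x,y) = Σ_a Σ_b Σ_z q μ0 Σ_{x'} Σ_{y'} 𝟙𝟙 Ψ`
  have step1 : (Q *ᵥ Ψ) (x, y)
      = ∑ a, ∑ b, ∑ z, ∑ x', ∑ y', optimalCoupling (u x) (u y) a b * μ0 z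
        * (if comp x' + Pi.single a 1 = comp x + Pi.single z 1 then (1 : ℝ) else 0) * (if comp y' + Pi.single b 1 = comp y + Pi.single z 1 then (1 : ℝ) else 0)
        * Ψ (x', y') := by
    simp only [Matrix.mulVec, dotProduct, Fintype.sum_prod_type]
    rw [← sum5_reorder]
    refine sum_congr rfl fun x' _ => sum_congr rfl fun y' _ => ?_
    rw [hQ, Finset.sum_mul]
    refine sum_congr rfl fun a _ => ?_
    rw [Finset.sum_mul]
    refine sum_congr rfl fun b _ => ?_
    rw [Finset.sum_mul]
  rw [step1]
  refine sum_congr rfl fun a _ => sum_congr rfl fun b _ => ?_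
  by_cases hqab : optimalCoupling (u x) (u y) a b = 0
  · simp [hqab]
  obtain ⟨hxa, hyb⟩ := urnChain_support hq hqab
  have hMx := urnChain_survivor (comp x) (urnChain_u_ne_zero hu hxa)
  have hMy := urnChain_survivor (comp y) (urnChain_u_ne_zero hu hyb)
  -- Step 2: the inner double sum over `x', y'` picks the unique targets
  have hinner : ∀ z, ∑ x', ∑ y', optimalCoupling (u x) (u y) a b * μ0 z
      * (if comp x' + Pi.single a 1 = comp x + Pi.single z 1 then (1 : ℝ) else 0) * (if comp y' + Pi.single b 1 = comp y + Pi.single z 1 then (1 : ℝ) else 0)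
      * Ψ (x', y')
      = optimalCoupling (u x) (u y) a b * μ0 z * ((Δ (comp x - Pi.single a 1) (comp y - Pi.single b 1) : ℝ)
        * ((2 + ∑ v, θ v * (comp x v : ℝ) + ∑ v, θ v * (comp y v : ℝ)) + 2 * θ z - θ a - θ b)) := by
    intro z
    -- sum over `y'` first
    have hy : ∀ x', ∑ y', optimalCoupling (u x) (u y) a b * μ0 z
        * (if comp x' + Pi.single a 1 = comp x + Pi.single z 1 then (1 : ℝ) else 0) * (if comp y' + Pi.single b 1 = comp y + Pi.single z 1 then (1 : ℝ) else 0)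
        * Ψ (x', y')
        = optimalCoupling (u x) (u y) a b * μ0 z * (if comp x' + Pi.single a 1 = comp x + Pi.single z 1 then (1 : ℝ) else 0)
          * ((Δ (comp x') (comp y - Pi.single b 1 + Pi.single z 1) : ℝ)
            * (2 + ∑ v, θ v * (comp x' v : ℝ) + ∑ v, θ v * ((comp y - Pi.single b 1 + Pi.single z 1 : S → ℕ) v : ℝ))) := by
      intro x'
      have h := urnChain_target_unique hinj hsum hsurj hMy z
        (fun N => (Δ (comp x') N : ℝ) * (2 + ∑ v, θ v * (comp x' v : ℝ) + ∑ v, θ v * ((N v : ℕ) : ℝ)))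
      rw [← h, Finset.mul_sum]
      refine sum_congr rfl fun y' _ => ?_
      rw [hΨ]
      by_cases hc : comp y' + Pi.single b 1 = comp y + Pi.single z 1
      · rw [if_pos hc, if_pos hc]; ring
      · rw [if_neg hc, if_neg hc]; ring
    simp_rw [hy]
    have h := urnChain_target_unique hinj hsum hsurj hMx z
      (fun N => (Δ N (comp y - Pi.single b 1 + Pi.single z 1) : ℝ)
        * (2 + ∑ v, θ v * ((N v : ℕ) : ℝ) + ∑ v, θ v * ((comp y - Pi.single b 1 + Pi.single z 1 : S → ℕ) v : ℝ)))
    have h' : ∑ x', optimalCoupling (u x) (u y) a b * μ0 z * (if comp x' + Pi.single a 1 = comp x + Pi.single z 1 then (1 : ℝ) else 0)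
          * ((Δ (comp x') (comp y - Pi.single b 1 + Pi.single z 1) : ℝ)
            * (2 + ∑ v, θ v * (comp x' v : ℝ) + ∑ v, θ v * ((comp y - Pi.single b 1 + Pi.single z 1 : S → ℕ) v : ℝ)))
        = optimalCoupling (u x) (u y) a b * μ0 z * ∑ x', (if comp x' + Pi.single a 1 = comp x + Pi.single z 1 then
            (Δ (comp x') (comp y - Pi.single b 1 + Pi.single z 1) : ℝ)
              * (2 + ∑ v, θ v * (comp x' v : ℝ) + ∑ v, θ v * ((comp y - Pi.single b 1 + Pi.single z 1 : S → ℕ) v : ℝ)) else 0) := by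
      rw [Finset.mul_sum]
      refine sum_congr rfl fun x' _ => ?_
      by_cases hc : comp x' + Pi.single a 1 = comp x + Pi.single z 1
      · rw [if_pos hc, if_pos hc]; ring
      · rw [if_neg hc, if_neg hc]; ring
    rw [h', h, cdist_add_single_same hΔ, urnChain_mass_add_single, urnChain_mass_add_single]
    have ex : ∑ v, θ v * (comp x v : ℝ) = ∑ v, θ v * ((comp x - Pi.single a 1 : S → ℕ) v : ℝ) + θ a := by
      conv_lhs => rw [hMx]
      exact urnChain_mass_add_single _ a
    have ey : ∑ v, θ v * (comp y v : ℝ) = ∑ v, θ v * ((comp y - Pi.single b 1 : S → ℕ) v : ℝ) + θ b := by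
      conv_lhs => rw [hMy]
      exact urnChain_mass_add_single _ b
    rw [ex, ey]
    ring
  simp_rw [hinner]
  -- Step 3: the sum over `z`
  have hsplit : ∀ z, optimalCoupling (u x) (u y) a b * μ0 z * ((Δ (comp x - Pi.single a 1) (comp y - Pi.single b 1) : ℝ)
        * ((2 + ∑ v, θ v * (comp x v : ℝ) + ∑ v, θ v * (comp y v : ℝ)) + 2 * θ z - θ a - θ b))
      = μ0 z * (optimalCoupling (u x) (u y) a b * ((Δ (comp x - Pi.single a 1) (comp y - Pi.single b 1) : ℝ)
          * ((2 + ∑ v, θ v * (comp x v : ℝ) + ∑ v, θ v * (comp y v : ℝ)) - θ a - θ b)))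
        + μ0 z * θ z * (2 * optimalCoupling (u x) (u y) a b * (Δ (comp x - Pi.single a 1) (comp y - Pi.single b 1) : ℝ)) := by
    intro z; ring
  simp_rw [hsplit]
  rw [sum_add_distrib, ← Finset.sum_mul, ← Finset.sum_mul, hμ1, one_mul]
  ring

omit [DecidableEq X] in
/-- **THE CONTRACTION `Q·Ψ ≤ (1 − p/(2K+4))·Ψ`** (file 6). [ours] -/
theorem urnChain_contract (hinj : Function.Injective comp) (hsum : ∀ x, ∑ v, comp x v = K + 1)
    (hsurj : ∀ N : S → ℕ, ∑ v, N v = K + 1 → ∃ x, comp x = N) (hW : ∀ v, 0 < W v) (hp0 : 0 ≤ p) (hp : ∀ v, p * W v ≤ 1)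
    (hθ : ∀ v, θ v = 1 / (1 + p * W v)) (hμ0 : ∀ v, 0 ≤ μ0 v) (hμ1 : ∑ v, μ0 v = 1) (hμW : ∑ v, μ0 v * W v = 1)
    (hZ : ∀ x, Zc x = ∑ v, (comp x v : ℝ) / W v) (hu : ∀ x v, u x v = (comp x v : ℝ) / W v / Zc x)
    (hΔ : ∀ N N', Δ N N' = ∑ v, (N v - N' v))
    (hQ : ∀ x y x' y', Q (x, y) (x', y') = ∑ a, ∑ b, ∑ z, optimalCoupling (u x) (u y) a b * μ0 z
      * (if comp x' + Pi.single a 1 = comp x + Pi.single z 1 then (1 : ℝ) else 0) * (if comp y' + Pi.single b 1 = comp y + Pi.single z 1 then (1 : ℝ) else 0))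
    (hΨ : ∀ x y, Ψ (x, y) = (Δ (comp x) (comp y) : ℝ) * (2 + ∑ v, θ v * ((comp x v : ℝ)) + ∑ v, θ v * (comp y v : ℝ))) (xy : X × X) :
    (Q *ᵥ Ψ) xy ≤ (1 - p / (2 * K + 4)) * Ψ xy := by
  obtain ⟨x, y⟩ := xy
  have hZ0 := urnChain_Z_pos hsum hW hZ
  rw [urnChain_mulVec_potential hinj hsum hsurj hW hμ1 hZ hu hΔ hQ hΨ x y, hΨ]
  have h := urn_product_certificate (Δ := Δ) (NX := comp x) (NY := comp y) hΔ (fun a => comp x - Pi.single a 1) (fun b => comp y - Pi.single b 1) hW hp0 hp hθ hμ0 hμ1 hμW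
    (hZ x) (hZ y) (hZ0 x) (hZ0 y) (hu x) (hu y) (hsum x) (hsum y)
    (fun a ha => urnChain_survivor (comp x) (urnChain_u_ne_zero hu ha)) (fun b hb => urnChain_survivor (comp y) (urnChain_u_ne_zero hu hb))
  calc _ ≤ (1 - p / (2 * K + 4)) * (Δ (comp x) (comp y) : ℝ) * (2 + ∑ v, θ v * (comp x v : ℝ) + ∑ v, θ v * (comp y v : ℝ)) := h
    _ = _ := by ring

omit [Fintype X] [DecidableEq X] [DecidableEq S] in
/-- **Bounds on the potential:** `Ψ ≥ 0`, `Ψ ≥ 𝟙{x ≠ y}`, `Ψ ≤ (K+1)(2K+4)`. [ours] -/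
theorem urnChain_potential_bounds (hinj : Function.Injective comp) (hsum : ∀ x, ∑ v, comp x v = K + 1) (hW : ∀ v, 0 < W v) (hp0 : 0 ≤ p) (hp : ∀ v, p * W v ≤ 1)
    (hθ : ∀ v, θ v = 1 / (1 + p * W v)) (hΔ : ∀ N N', Δ N N' = ∑ v, (N v - N' v))
    (hΨ : ∀ x y, Ψ (x, y) = (Δ (comp x) (comp y) : ℝ) * (2 + ∑ v, θ v * ((comp x v : ℝ)) + ∑ v, θ v * (comp y v : ℝ))) (x y : X) :
    0 ≤ Ψ (x, y) ∧ (x ≠ y → 1 ≤ Ψ (x, y)) ∧ Ψ (x, y) ≤ (K + 1) * (2 * K + 4) := by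
  have hsw := urn_product_sandwich (NX := comp x) (NY := comp y) hW hp0 hp hθ (hsum x) (hsum y) (Δ (comp x) (comp y) : ℝ) (Nat.cast_nonneg _)
  rw [hΨ]
  refine ⟨le_trans (Nat.cast_nonneg _) hsw.1, fun hxy => ?_, ?_⟩
  · have hne : comp x ≠ comp y := fun h => hxy (hinj h)
    have hΔ1 : (1 : ℝ) ≤ (Δ (comp x) (comp y) : ℝ) := by
      have : Δ (comp x) (comp y) ≠ 0 := fun h0 => hne (eq_of_cdist_eq_zero hΔ (by rw [hsum x, hsum y]) h0)
      exact_mod_cast Nat.one_le_iff_ne_zero.mpr this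
    exact hΔ1.trans hsw.1
  · have hΔle : (Δ (comp x) (comp y) : ℝ) ≤ K + 1 := by
      have := cdist_le_sum hΔ (comp x) (comp y); rw [hsum x] at this; exact_mod_cast this
    calc _ ≤ (2 * K + 4) * (Δ (comp x) (comp y) : ℝ) := hsw.2
      _ ≤ (2 * K + 4) * (K + 1) := mul_le_mul_of_nonneg_left hΔle (by positivity)
      _ = (K + 1) * (2 * K + 4) := by ring

/-! ## §4 The law -/

/-- **THE URN COMPOSITION CHAIN MIXES AT THE LAW-FREE RATE `p/(2K+4)`:** for any stationary law `π` of `P`,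
`d(n) ≤ (K+1)(2K+4)·(1 − p/(2K+4))ⁿ`. [ours] -/
theorem urnChain_worstTvDist_le [Nonempty X] (hinj : Function.Injective comp) (hsum : ∀ x, ∑ v, comp x v = K + 1)
    (hsurj : ∀ N : S → ℕ, ∑ v, N v = K + 1 → ∃ x, comp x = N) (hW : ∀ v, 0 < W v) (hp0 : 0 ≤ p) (hp : ∀ v, p * W v ≤ 1)
    (hθ : ∀ v, θ v = 1 / (1 + p * W v)) (hμ0 : ∀ v, 0 ≤ μ0 v) (hμ1 : ∑ v, μ0 v = 1) (hμW : ∑ v, μ0 v * W v = 1)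
    (hZ : ∀ x, Zc x = ∑ v, (comp x v : ℝ) / W v) (hu : ∀ x v, u x v = (comp x v : ℝ) / W v / Zc x)
    (hΔ : ∀ N N', Δ N N' = ∑ v, (N v - N' v))
    (hP : ∀ x x', P x x' = ∑ a, ∑ z, u x a * μ0 z * (if comp x' + Pi.single a 1 = comp x + Pi.single z 1 then (1 : ℝ) else 0))
    (hQ : ∀ x y x' y', Q (x, y) (x', y') = ∑ a, ∑ b, ∑ z, optimalCoupling (u x) (u y) a b * μ0 z
      * (if comp x' + Pi.single a 1 = comp x + Pi.single z 1 then (1 : ℝ) else 0) * (if comp y' + Pi.single b 1 = comp y + Pi.single z 1 then (1 : ℝ) else 0))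
    (hΨ : ∀ x y, Ψ (x, y) = (Δ (comp x) (comp y) : ℝ) * (2 + ∑ v, θ v * ((comp x v : ℝ)) + ∑ v, θ v * (comp y v : ℝ)))
    {π : X → ℝ} (hπ : IsStationary π P) (hπ0 : ∀ x, 0 ≤ π x) (hπ1 : ∑ x, π x = 1) (n : ℕ) :
    worstTvDist P π n ≤ (K + 1) * (2 * K + 4) * (1 - p / (2 * K + 4)) ^ n := by
  have hQc := urnChain_isMarkovianCoupling hinj hsum hsurj hW hμ0 hZ hu hP hQ
  have hp1 := urn_p_le_one hp hμ0 hμ1 hμW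
  have hK0 : (0 : ℝ) ≤ 2 * K := by positivity
  have hρ1 : p / (2 * K + 4) ≤ 1 := by
    rw [div_le_one (by positivity)]; linarith
  have hbounds := urnChain_potential_bounds hinj hsum hW hp0 hp hθ hΔ hΨ
  have hQ0 : ∀ z z' : X × X, 0 ≤ Q z z' := fun z z' => by
    obtain ⟨x, y⟩ := z; obtain ⟨x', y'⟩ := z'
    exact (hQc x y).1 x' y'
  have hcontr := urnChain_contract hinj hsum hsurj hW hp0 hp hθ hμ0 hμ1 hμW hZ hu hΔ hQ hΨ
  refine LevinPeres2017_cor_5_5 hπ hπ0 hπ1 fun x0 y0 => ⟨Q, hQc, ?_⟩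
  -- the indicator of the off-diagonal
  set ind : X × X → ℝ := fun ab => if ab.1 = ab.2 then (0 : ℝ) else 1 with hind
  -- `P{X_n ≠ Y_n} = (Qⁿ·𝟙_{≠})(x0,y0) ≤ (Qⁿ·Ψ)(x0,y0) ≤ (1−ρ)ⁿ Ψ(x0,y0) ≤ (1−ρ)ⁿ Ψ_max`
  have hoff : ∑ a, ∑ b ∈ univ.erase a, kernelAt Q n (x0, y0) (a, b) = ((Q ^ n) *ᵥ ind) (x0, y0) := by
    simp only [Matrix.mulVec, dotProduct, Fintype.sum_prod_type]
    refine sum_congr rfl fun a _ => ?_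
    have hdiag : (fun b => (Q ^ n) (x0, y0) (a, b) * ind (a, b)) a = 0 := by simp [hind]
    have hsplit : ∑ b, (Q ^ n) (x0, y0) (a, b) * ind (a, b) = ∑ b ∈ univ.erase a, (Q ^ n) (x0, y0) (a, b) * ind (a, b) :=
      (Finset.sum_erase (f := fun b => (Q ^ n) (x0, y0) (a, b) * ind (a, b)) univ hdiag).symm
    rw [hsplit]
    refine sum_congr rfl fun b hb => ?_
    have hab : a ≠ b := (ne_of_mem_erase hb).symm
    rw [kernelAt_eq_pow_apply, hind]
    simp [hab]
  rw [hoff]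
  have hind_le : ∀ ab : X × X, ind ab ≤ Ψ ab := by
    rintro ⟨a, b⟩
    by_cases hab : a = b
    · rw [hind]; simp only [hab, if_true]; exact (hbounds b b).1
    · rw [hind]; simp only [if_neg hab]; exact (hbounds a b).2.1 hab
  calc ((Q ^ n) *ᵥ ind) (x0, y0) ≤ ((Q ^ n) *ᵥ Ψ) (x0, y0) := urnChain_pow_mono hQ0 hind_le n (x0, y0)
    _ ≤ (1 - p / (2 * K + 4)) ^ n * Ψ (x0, y0) := urnChain_geometric hQ0 hρ1 hcontr n (x0, y0)
    _ ≤ (1 - p / (2 * K + 4)) ^ n * ((K + 1) * (2 * K + 4)) :=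
        mul_le_mul_of_nonneg_left (hbounds x0 y0).2.2 (pow_nonneg (by linarith) n)
    _ = (K + 1) * (2 * K + 4) * (1 - p / (2 * K + 4)) ^ n := by ring

/-- **`t_mix(ε) ≤ ⌈((2K+4)/p)·log((K+1)(2K+4)/ε)⌉₊`** for the urn composition chain (`0 < p`, `0 < ε`). [ours] -/
theorem urnChain_mixingTime_le [Nonempty X] (hinj : Function.Injective comp) (hsum : ∀ x, ∑ v, comp x v = K + 1)
    (hsurj : ∀ N : S → ℕ, ∑ v, N v = K + 1 → ∃ x, comp x = N) (hW : ∀ v, 0 < W v) (hp0 : 0 < p) (hp : ∀ v, p * W v ≤ 1)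
    (hθ : ∀ v, θ v = 1 / (1 + p * W v)) (hμ0 : ∀ v, 0 ≤ μ0 v) (hμ1 : ∑ v, μ0 v = 1) (hμW : ∑ v, μ0 v * W v = 1)
    (hZ : ∀ x, Zc x = ∑ v, (comp x v : ℝ) / W v) (hu : ∀ x v, u x v = (comp x v : ℝ) / W v / Zc x)
    (hΔ : ∀ N N', Δ N N' = ∑ v, (N v - N' v))
    (hP : ∀ x x', P x x' = ∑ a, ∑ z, u x a * μ0 z * (if comp x' + Pi.single a 1 = comp x + Pi.single z 1 then (1 : ℝ) else 0))
    (hQ : ∀ x y x' y', Q (x, y) (x', y') = ∑ a, ∑ b, ∑ z, optimalCoupling (u x) (u y) a b * μ0 z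
      * (if comp x' + Pi.single a 1 = comp x + Pi.single z 1 then (1 : ℝ) else 0) * (if comp y' + Pi.single b 1 = comp y + Pi.single z 1 then (1 : ℝ) else 0))
    (hΨ : ∀ x y, Ψ (x, y) = (Δ (comp x) (comp y) : ℝ) * (2 + ∑ v, θ v * ((comp x v : ℝ)) + ∑ v, θ v * (comp y v : ℝ)))
    {π : X → ℝ} (hπ : IsStationary π P) (hπ0 : ∀ x, 0 ≤ π x) (hπ1 : ∑ x, π x = 1) {ε : ℝ} (hε : 0 < ε) :
    mixingTime P π ε ≤ ⌈1 / (p / (2 * K + 4)) * Real.log ((K + 1) * (2 * K + 4) / ε)⌉₊ := by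
  have hK0 : (0 : ℝ) < 2 * K + 4 := by positivity
  have hρ0 : 0 < p / (2 * K + 4) := div_pos hp0 hK0
  refine mixingTime_le _ _ ((urnChain_worstTvDist_le hinj hsum hsurj hW hp0.le hp hθ hμ0 hμ1 hμW hZ hu hΔ hP hQ hΨ hπ hπ0 hπ1 _).trans ?_)
  -- `(1−ρ)ⁿ ≤ exp(−ρ n)`
  have hgeo : (1 - p / (2 * K + 4)) ^ (⌈1 / (p / (2 * K + 4)) * Real.log ((K + 1) * (2 * K + 4) / ε)⌉₊)
      ≤ Real.exp (-(p / (2 * K + 4)) * (⌈1 / (p / (2 * K + 4)) * Real.log ((K + 1) * (2 * K + 4) / ε)⌉₊ : ℕ)) := by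
    have h1 : 1 - p / (2 * K + 4) ≤ Real.exp (-(p / (2 * K + 4))) := by
      have := Real.add_one_le_exp (-(p / (2 * K + 4))); linarith
    have h0 : 0 ≤ 1 - p / (2 * K + 4) := by
      have hp1 := urn_p_le_one hp hμ0 hμ1 hμW
      rw [sub_nonneg, div_le_one hK0]
      have : (0 : ℝ) ≤ 2 * K := by positivity
      linarith
    calc (1 - p / (2 * K + 4)) ^ (⌈1 / (p / (2 * K + 4)) * Real.log ((K + 1) * (2 * K + 4) / ε)⌉₊)
        ≤ (Real.exp (-(p / (2 * K + 4)))) ^ (⌈1 / (p / (2 * K + 4)) * Real.log ((K + 1) * (2 * K + 4) / ε)⌉₊) := pow_le_pow_left₀ h0 h1 _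
      _ = Real.exp (-(p / (2 * K + 4)) * (⌈1 / (p / (2 * K + 4)) * Real.log ((K + 1) * (2 * K + 4) / ε)⌉₊ : ℕ)) := by
          rw [← Real.exp_nat_mul]; ring_nf
  calc (K + 1 : ℝ) * (2 * K + 4) * (1 - p / (2 * K + 4)) ^ (⌈1 / (p / (2 * K + 4)) * Real.log ((K + 1) * (2 * K + 4) / ε)⌉₊)
      ≤ (K + 1) * (2 * K + 4) * Real.exp (-(p / (2 * K + 4)) * (⌈1 / (p / (2 * K + 4)) * Real.log ((K + 1) * (2 * K + 4) / ε)⌉₊ : ℕ)) :=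
        mul_le_mul_of_nonneg_left hgeo (by positivity)
    _ ≤ ε := exp_le_of_ge_log hρ0 (by positivity) hε (Nat.le_ceil _)

end UrnChainLaw

end Summit.Ventures.LatticeQCDFlow.Scaling
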